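import Summits.Ventures.LatticeQCDFlow.Scaling.WeightedPathCoupling

/-!
HONEST FRAMING: exact (Metropolis-corrected) sampling algorithms for lattice gauge theory; figures
of merit are autocorrelation/cost numbers at stated couplings and volumes; no continuum-physics
claim.

# WeightedPathCouplingPairRates — BUBLEY–DYER ALONG THE PATH PSEUDO-METRIC WITH EDGE-DEPENDENT, ATTEMPT-INDEXED SIGNED RATES: FROM `E_θ d(X_j,Y_j) ≤ (1−r_j(e))ℓ(e)` ON EVERY
# EDGE WITH `−q ≤ r_j(e) ≤ 1` AND `Σ_{j<n}σʲ(1−σ)(1−r_j(e)) ≤ 1 − r̃`, PAIR RATES `r_j(x,y)` WITH `ρ_K(P_j(x,·),P_j(y,·)) ≤ (1−r_j(x,y))d(x,y)`, `−(2q+1) ≤ r_j(x,y) ≤ 1` AND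
# `Σ_{j<n}σʲ(1−σ)(1−r_j(x,y)) ≤ 1 − r̃/2` AT EVERY PAIR (lean-2 GEN-43, ours)

Venture-side (OURS).  Cell `lqcd-flow` (pub-lqcd), unit `pub-lqcd-lean-2-g43`, 2026-08-31.  Chapter AC, file 5 — the second piece of the C2 ∕ C4 assembly for the lumped star: the
path-coupling layer between the per-EDGE per-attempt-count data that the certificates of chapters Z–AC deliver and the per-PAIR hypotheses of file 4 (`ClockConditionedPairRates`).
Chapter W file 17 (`wpath_transportDist_le`) propagates a UNIFORM edge factor `c`; here the factor depends on the edge and on the attempt count `j`, and what must propagate with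
it are the two side conditions of file 4: the bounds `−q ≤ r ≤ 1` and the discounted mean `Σ_{j<n}σʲ(1−σ)(1−r_j) ≤ 1 − r̃`.  Along a fixed `E`-path `x ⇝ y` of `ℓ`-length `L` the
transport distances add (LPW Lemma 14.3, tree), so `f_j := Σ_{edges}(1−r_j(e))ℓ(e)` bounds `ρ_K(P_j(x,·),P_j(y,·))` with `0 ≤ f_j ≤ (1+q)L` and `Σ_{j<n}σʲ(1−σ)f_j ≤ (1−r̃)L`
(`wpathRates_along`); choosing ONE `(r̃/2)`-good path per pair (`L ≤ d(x,y) + r̃/2`, `d ≥ 1` off the diagonal) and `r_j(x,y) := 1 − f_j/d(x,y)` (`:= 1` on the diagonal) gives the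
three per-pair hypotheses of file 4 with `q' = (1+q)(1+r̃/2) − 1 ≤ 2q+1` and `r̃' = r̃/2` (`(1−r̃)(1+r̃/2) ≤ 1 − r̃/2`).

* §1 `wpathRates_along` (induction along a path), §2 **`wpathRates_exists`** (the per-pair rates, existentially, with the three properties).

Hypothesis-functions as in W17 (`hle`, `happrox` for the pseudo-metric `d` of edge lengths `ℓ ≥ 1`); the kernels `P_j` need only be row-stochastic.  Literature grade (cell rule):
OWN, elementary re-plumbing of Bubley–Dyer ∕ LPW §14.2 (cited in the tree's Literature file); nothing new cited; no new bib keys.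
-/

open Finset
open Literature.Probability.MarkovChains

namespace Summit.Ventures.LatticeQCDFlow.Scaling

section WPathRates
variable {X : Type*} [Fintype X] {E : X → X → Prop} {ℓ d : X → X → ℝ} {P : ℕ → X → X → ℝ} {re : ℕ → X → X → ℝ} {σ rt q : ℝ}

/-- **Along a path the per-attempt bounds, their size and their discounted means add.**  For row-stochastic `P_j`, `d ≥ 0` with `d(x,x) = 0` and the triangle inequality, edge data
`E_θ d ≤ (1−r_j(e))ℓ(e)` with `−q ≤ r_j(e) ≤ 1`, `ℓ(e) ≥ 0`, `Σ_{j<n}σʲ(1−σ)(1−r_j(e)) ≤ 1−r̃` (any real `σ`), and an `E`-path `x ⇝ y` of `ℓ`-length `L`: there is `f : ℕ → ℝ` with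
`ρ_K(P_j(x,·),P_j(y,·)) ≤ f_j`, `0 ≤ f_j ≤ (1+q)L`, `Σ_{j<n}σʲ(1−σ)f_j ≤ (1−r̃)L`. [ours] -/
theorem wpathRates_along (hP : ∀ j, IsRowStochastic (P j)) (hd0 : ∀ a b, 0 ≤ d a b) (hdd : ∀ a, d a a = 0) (hdt : ∀ x y z, d x z ≤ d x y + d y z)
    (hℓ : ∀ a b, E a b → 0 ≤ ℓ a b)
    (hedge : ∀ j a b, E a b → ∃ θ, IsCoupling (P j a) (P j b) θ ∧ transportCost d θ ≤ (1 - re j a b) * ℓ a b)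
    (hrq : ∀ j a b, E a b → -q ≤ re j a b) (hr1 : ∀ j a b, E a b → re j a b ≤ 1)
    (hmean : ∀ n a b, E a b → ∑ j ∈ range n, σ ^ j * (1 - σ) * (1 - re j a b) ≤ 1 - rt)
    {x y : X} {L : ℝ} (hpath : IsGraphPath E ℓ x y L) :
    ∃ f : ℕ → ℝ, (∀ j, transportDist d (P j x) (P j y) ≤ f j) ∧ (∀ j, 0 ≤ f j) ∧ (∀ j, f j ≤ (1 + q) * L)
      ∧ ∀ n, ∑ j ∈ range n, σ ^ j * (1 - σ) * f j ≤ (1 - rt) * L := by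
  have hne : ∀ j a b, (couplings (P j a) (P j b)).Nonempty := fun j a b =>
    couplings_nonempty ((hP j).1 a) ((hP j).1 b) ((hP j).2 a) ((hP j).2 b)
  induction hpath with
  | nil a =>
      refine ⟨fun _ => 0, fun j => ?_, fun _ => le_rfl, fun _ => by simp, fun n => by simp⟩
      rw [transportDist_self hd0 hdd ((hP j).1 a)]
  | @cons a m b L hE hp ih =>
      obtain ⟨f, hf, hf0, hfL, hfm⟩ := ih
      have hL0 : 0 ≤ L := graphPath_length_nonneg hℓ hp
      refine ⟨fun j => (1 - re j a m) * ℓ a m + f j, fun j => ?_, fun j => ?_, fun j => ?_, fun n => ?_⟩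
      · obtain ⟨θ, hθ, hθc⟩ := hedge j a m hE
        calc transportDist d (P j a) (P j b) ≤ transportDist d (P j a) (P j m) + transportDist d (P j m) (P j b) :=
              LevinPeres2017_lemma_14_3 hdt (hne j a m) (hne j m b)
          _ ≤ (1 - re j a m) * ℓ a m + f j := add_le_add ((transportDist_le hθ).trans hθc) (hf j)
      · exact add_nonneg (mul_nonneg (by linarith [hr1 j a m hE]) (hℓ a m hE)) (hf0 j)
      · have h1 : (1 - re j a m) * ℓ a m ≤ (1 + q) * ℓ a m := mul_le_mul_of_nonneg_right (by linarith [hrq j a m hE]) (hℓ a m hE)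
        have h2 := hfL j
        nlinarith
      · have e : ∑ j ∈ range n, σ ^ j * (1 - σ) * ((1 - re j a m) * ℓ a m + f j)
            = ℓ a m * ∑ j ∈ range n, σ ^ j * (1 - σ) * (1 - re j a m) + ∑ j ∈ range n, σ ^ j * (1 - σ) * f j := by
          rw [mul_sum, ← sum_add_distrib]; exact sum_congr rfl fun j _ => by ring
        rw [e]
        have h1 := mul_le_mul_of_nonneg_left (hmean n a m hE) (hℓ a m hE)
        have h2 := hfm n
        nlinarith

/-- **THE PER-PAIR RATES** (see the module docstring): under the edge data of `wpathRates_along` with `ℓ ≥ 1` on edges, `0 < r̃`, `0 ≤ q`, and the pseudo-metric `d` of W17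
(`hle`, `happrox`), there are rates `r_j(x,y)` with `ρ_K(P_j(x,·),P_j(y,·)) ≤ (1−r_j(x,y))·d(x,y)`, `−(2q+1) ≤ r_j(x,y) ≤ 1` and `Σ_{j<n}σʲ(1−σ)(1−r_j(x,y)) ≤ 1 − r̃/2` for every
`n` and every pair — the hypotheses of `clock_worstTvDist_le_pairRates` with `q' = 2q+1`, `r̃' = r̃/2`. [ours] -/
theorem wpathRates_exists (hP : ∀ j, IsRowStochastic (P j)) (hℓ1 : ∀ a b, E a b → 1 ≤ ℓ a b)
    (hle : ∀ x y L, IsGraphPath E ℓ x y L → d x y ≤ L) (happrox : ∀ x y ε, 0 < ε → ∃ L, IsGraphPath E ℓ x y L ∧ L ≤ d x y + ε)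
    (hrt0 : 0 < rt) (hrt1 : rt ≤ 1) (hq : 0 ≤ q)
    (hedge : ∀ j a b, E a b → ∃ θ, IsCoupling (P j a) (P j b) θ ∧ transportCost d θ ≤ (1 - re j a b) * ℓ a b)
    (hrq : ∀ j a b, E a b → -q ≤ re j a b) (hr1 : ∀ j a b, E a b → re j a b ≤ 1)
    (hmean : ∀ n a b, E a b → ∑ j ∈ range n, σ ^ j * (1 - σ) * (1 - re j a b) ≤ 1 - rt) :
    ∃ r : ℕ → X → X → ℝ, (∀ j x y, transportDist d (P j x) (P j y) ≤ (1 - r j x y) * d x y)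
      ∧ (∀ j x y, -(2 * q + 1) ≤ r j x y) ∧ (∀ j x y, r j x y ≤ 1)
      ∧ ∀ n x y, ∑ j ∈ range n, σ ^ j * (1 - σ) * (1 - r j x y) ≤ 1 - rt / 2 := by
  classical
  have hℓ : ∀ a b, E a b → 0 ≤ ℓ a b := fun a b h => zero_le_one.trans (hℓ1 a b h)
  have hd0 : ∀ a b, 0 ≤ d a b := wpath_nonneg hℓ happrox
  have hdd : ∀ a, d a a = 0 := wpath_self hℓ hle happrox
  have hdt : ∀ x y z, d x z ≤ d x y + d y z := wpath_triangle hle happrox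
  -- one `(r̃/2)`-good path per pair, and the additive bound along it
  have key : ∀ x y, ∃ f : ℕ → ℝ, (∀ j, transportDist d (P j x) (P j y) ≤ f j) ∧ (∀ j, 0 ≤ f j) ∧ (∀ j, f j ≤ (1 + q) * (d x y + rt / 2))
      ∧ ∀ n, ∑ j ∈ range n, σ ^ j * (1 - σ) * f j ≤ (1 - rt) * (d x y + rt / 2) := by
    intro x y
    obtain ⟨L, hL, hLe⟩ := happrox x y (rt / 2) (by linarith)
    obtain ⟨f, hf, hf0, hfL, hfm⟩ := wpathRates_along hP hd0 hdd hdt hℓ hedge hrq hr1 hmean hL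
    refine ⟨f, hf, hf0, fun j => (hfL j).trans (mul_le_mul_of_nonneg_left hLe (by linarith)), fun n => (hfm n).trans ?_⟩
    exact mul_le_mul_of_nonneg_left hLe (by linarith)
  choose f hf hf0 hfL hfm using key
  refine ⟨fun j x y => if x = y then 1 else 1 - f x y j / d x y, fun j x y => ?_, fun j x y => ?_, fun j x y => ?_, fun n x y => ?_⟩ <;> dsimp only
  · by_cases hxy : x = y
    · subst hxy; rw [if_pos rfl, transportDist_self hd0 hdd ((hP j).1 x)]; simp
    · have hd1 : 1 ≤ d x y := wpath_ge_one hℓ1 happrox hxy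
      rw [if_neg hxy]
      have e : (1 - (1 - f x y j / d x y)) * d x y = f x y j := by field_simp; ring
      rw [e]; exact hf x y j
  · by_cases hxy : x = y
    · subst hxy; rw [if_pos rfl]; linarith
    · have hd1 : 1 ≤ d x y := wpath_ge_one hℓ1 happrox hxy
      rw [if_neg hxy]
      -- `f ≤ (1+q)(d + r̃/2) ≤ (1+q)(1 + r̃/2)·d ≤ (2q+2)·d`
      have h1 : f x y j / d x y ≤ (1 + q) * (1 + rt / 2) := by
        rw [div_le_iff₀ (by linarith)]
        have := hfL x y j
        nlinarith [mul_nonneg (by linarith : (0:ℝ) ≤ 1 + q) (by linarith : (0:ℝ) ≤ d x y - 1)]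
      nlinarith [mul_nonneg hq hrt0.le]
  · by_cases hxy : x = y
    · subst hxy; rw [if_pos rfl]
    · have hd1 : 1 ≤ d x y := wpath_ge_one hℓ1 happrox hxy
      rw [if_neg hxy]
      have : 0 ≤ f x y j / d x y := div_nonneg (hf0 x y j) (by linarith)
      linarith
  · by_cases hxy : x = y
    · subst hxy
      have e : ∑ j ∈ range n, σ ^ j * (1 - σ) * (1 - (if x = x then (1:ℝ) else 1 - f x x j / d x x)) = 0 :=
        sum_eq_zero fun j _ => by rw [if_pos rfl, sub_self, mul_zero]
      rw [e]; linarith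
    · have hd1 : 1 ≤ d x y := wpath_ge_one hℓ1 happrox hxy
      have hdpos : 0 < d x y := by linarith
      simp only [if_neg hxy, sub_sub_cancel]
      have e : ∑ j ∈ range n, σ ^ j * (1 - σ) * (f x y j / d x y) = (∑ j ∈ range n, σ ^ j * (1 - σ) * f x y j) / d x y := by
        rw [sum_div]; exact sum_congr rfl fun j _ => by ring
      rw [e, div_le_iff₀ hdpos]
      have h1 := hfm x y n
      -- `(1−r̃)(d + r̃/2) ≤ (1 − r̃/2)·d` since `d ≥ 1`
      nlinarith [mul_nonneg hrt0.le (by linarith : (0:ℝ) ≤ d x y - 1), mul_nonneg hrt0.le hrt0.le]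

end WPathRates

end Summit.Ventures.LatticeQCDFlow.Scaling
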